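import Summits.QuantumFields.QCD.Theses.IntegerCriticalLine
import Literature.MathematicalPhysics.QuantumLattice.GrassmannIntegralWilsonProofs
import HarnessLib

/-!
# `PionContractionEqNormSq` (stmt-QuantumFields-10518, route IntegerCriticalLine, support) — proved

The dictionary entry «second moment of the `E = 0` Green function = flavoured pseudoscalar correlator»: for every `SU(3)`
gauge field `U` on a four-torus, every real `m` and sites `x, y`, the equal-mass pion contraction
`tr[G(x,y) γ₅ G(y,x) γ₅]` equals `Σ_{a,b,α,β} |G(x,a,α; y,b,β)|²`, `G = D_W⁻¹` (Mathlib's `Matrix` inverse, `0` on the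
singular set — both sides then vanish).  Proof: γ₅-hermiticity of the Wilson–Dirac operator (tree fact
`wilsonDirac_gammaFive_hermitian_holds`: `Γ₅ D_W Γ₅ = D_Wᴴ`, `Γ₅ = diag(ε_α)`, `ε = (1,1,−1,−1)`) passes to the inverse
(`Matrix.mul_inv_rev`, `Matrix.conjTranspose_nonsing_inv`, `Γ₅² = 1`): `G(q,p) = ε_q · conj G(p,q) · ε_p`; with
`γ₅ = diag ε` the two inner spinor sums collapse and `ε² = 1` leaves `Σ |G|²`.
Width seat ym-line-sfw-p2-w2 g24 (cell ym-idea-1; free hands).  HONEST FRAMING: an exact lattice identity (support item);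
no crux, rung or summit is proved; nothing here bears on the Yang–Mills mass gap.
[cite: MontvayMunster1994, §5.1.2 (5.15)]
-/

set_option autoImplicit false

namespace Summit.QuantumFields.QCD.Theorems.IntegerCriticalLinePionContractionEqNormSq

open Literature.MathematicalPhysics.QuantumLattice Literature.MathematicalPhysics.QuantumFieldTheory
open Literature.Probability.LatticeModels Matrix

variable {L : ℕ} [NeZero L]

/-- **γ₅-hermiticity of the Wilson propagator, entrywise**: `G(q,p) = ε_q · conj G(p,q) · ε_p` for `G = D_W⁻¹`,
`ε = (1,1,−1,−1)` read on the spin index (from `Γ₅ D_W Γ₅ = D_Wᴴ`, inverted). [cite: MontvayMunster1994, §5.1.2 (5.15)] -/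
theorem inv_wilsonDirac_swap (U : GaugeConfig 4 L (Matrix.specialUnitaryGroup (Fin 3) ℂ)) (m r : ℝ)
    (p q : TorusSite 4 L × Fin 3 × Fin 4) :
    (wilsonDirac (fundamentalRep (Fin 3)) U m r)⁻¹ q p =
      (![1, 1, -1, -1] : Fin 4 → ℂ) q.2.2 * star ((wilsonDirac (fundamentalRep (Fin 3)) U m r)⁻¹ p q) *
        (![1, 1, -1, -1] : Fin 4 → ℂ) p.2.2 := by
  set D := wilsonDirac (fundamentalRep (Fin 3)) U m r with hD
  have hΓ := wilsonDirac_gammaFive_hermitian_holds (L := L) (fundamentalRep (Fin 3)) fundamentalRep_mem_unitaryGroup U m r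
  rw [← hD] at hΓ
  have hΓΓ := spinorLift_gammaFive_mul_self (L := L) (N := 3)
  have hΓinv : (spinorLift gammaFive : Matrix (TorusSite 4 L × Fin 3 × Fin 4) (TorusSite 4 L × Fin 3 × Fin 4) ℂ)⁻¹ =
      spinorLift gammaFive := Matrix.inv_eq_left_inv hΓΓ
  -- invert `Γ D Γ = Dᴴ`
  have hG : spinorLift gammaFive * D⁻¹ * spinorLift gammaFive = (D⁻¹)ᴴ := by
    have h := congrArg (fun M : Matrix (TorusSite 4 L × Fin 3 × Fin 4) (TorusSite 4 L × Fin 3 × Fin 4) ℂ => M⁻¹) hΓ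
    simp only [Matrix.mul_inv_rev, hΓinv] at h
    rw [← Matrix.mul_assoc] at h
    rw [h, Matrix.conjTranspose_nonsing_inv]
  have hqp := congrFun (congrFun hG q) p
  rw [spinorLift_gammaFive_eq_diagonal, mul_diagonal, diagonal_mul, conjTranspose_apply] at hqp
  -- `ε_q G_qp ε_p = conj G_pq` ⇒ `G_qp = ε_q conj(G_pq) ε_p`
  have hq := gammaFiveSign_mul_self q.2.2
  have hp := gammaFiveSign_mul_self p.2.2
  calc D⁻¹ q p = ((![1, 1, -1, -1] : Fin 4 → ℂ) q.2.2 * (![1, 1, -1, -1] : Fin 4 → ℂ) q.2.2) *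
        D⁻¹ q p * ((![1, 1, -1, -1] : Fin 4 → ℂ) p.2.2 * (![1, 1, -1, -1] : Fin 4 → ℂ) p.2.2) := by
          rw [hq, hp, one_mul, mul_one]
    _ = (![1, 1, -1, -1] : Fin 4 → ℂ) q.2.2 * ((![1, 1, -1, -1] : Fin 4 → ℂ) q.2.2 * D⁻¹ q p *
        (![1, 1, -1, -1] : Fin 4 → ℂ) p.2.2) * (![1, 1, -1, -1] : Fin 4 → ℂ) p.2.2 := by ring
    _ = (![1, 1, -1, -1] : Fin 4 → ℂ) q.2.2 * star (D⁻¹ p q) * (![1, 1, -1, -1] : Fin 4 → ℂ) p.2.2 := by rw [hqp]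

/-- **`PionContractionEqNormSq`** (stmt-QuantumFields-10518): `tr[G(x,y) γ₅ G(y,x) γ₅] = Σ |G(x,·;y,·)|²` for the Wilson
propagator `G = D_W(U, m, 1)⁻¹` of an `SU(3)` gauge field. [cite: MontvayMunster1994, §5.1.2 (5.15)] -/
theorem pionContractionEqNormSq_proof : Summit.QuantumFields.QCD.Theses.IntegerCriticalLine.PionContractionEqNormSq := by
  intro L _ U m x y
  -- collapse the two inner spinor sums: `γ₅ = diag ε`
  simp only [gammaFive_eq_diagonal, diagonal_apply, mul_ite, mul_zero, ite_mul, zero_mul, Finset.sum_ite_irrel,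
    Finset.sum_const_zero, Finset.sum_ite_eq, Finset.sum_ite_eq', Finset.mem_univ, if_true]
  refine Finset.sum_congr rfl fun a _ => Finset.sum_congr rfl fun b _ => Finset.sum_congr rfl fun α _ =>
    Finset.sum_congr rfl fun β _ => ?_
  rw [inv_wilsonDirac_swap U m 1 (x, a, α) (y, b, β)]
  have hα := gammaFiveSign_mul_self α
  have hβ := gammaFiveSign_mul_self β
  set g := (wilsonDirac (fundamentalRep (Fin 3)) U m 1)⁻¹ (x, a, α) (y, b, β)
  have hnorm : g * star g = (((‖g‖ ^ 2 : ℝ)) : ℂ) := by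
    rw [Complex.star_def, Complex.mul_conj, Complex.normSq_eq_norm_sq]
  calc g * (![1, 1, -1, -1] : Fin 4 → ℂ) β * ((![1, 1, -1, -1] : Fin 4 → ℂ) β * star g *
        (![1, 1, -1, -1] : Fin 4 → ℂ) α) * (![1, 1, -1, -1] : Fin 4 → ℂ) α
      = g * star g * ((![1, 1, -1, -1] : Fin 4 → ℂ) β * (![1, 1, -1, -1] : Fin 4 → ℂ) β) *
        ((![1, 1, -1, -1] : Fin 4 → ℂ) α * (![1, 1, -1, -1] : Fin 4 → ℂ) α) := by ring
    _ = (((‖g‖ ^ 2 : ℝ)) : ℂ) := by rw [hα, hβ, mul_one, mul_one, hnorm]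

end Summit.QuantumFields.QCD.Theorems.IntegerCriticalLinePionContractionEqNormSq

/-- **`IntegerCriticalLine.PionContractionEqNormSq` holds** (stmt-QuantumFields-10518), route-level name.
[cite: MontvayMunster1994, §5.1.2 (5.15)] -/
theorem Summit.QuantumFields.QCD.Theorems.integerCriticalLine_pionContractionEqNormSq_proof :
    Summit.QuantumFields.QCD.Theses.IntegerCriticalLine.PionContractionEqNormSq :=
  Summit.QuantumFields.QCD.Theorems.IntegerCriticalLinePionContractionEqNormSq.pionContractionEqNormSq_proof
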